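import Mathlib
import HarnessLib
import Literature.Analysis.Fourier.PowerKernelGradientFourierTransform
import Summits.AtomisticToContinuum.Crystallization.Theorems.HolmgrenBoyleLindHalfSpaceUniqueContinuationVerticalModeLaplace

/-!
# Route `HolmgrenBoyleLind`: Lennard-Jones force fields of separated sources, part 19 —
the HORIZONTAL modes of a source layer as Laplace transforms

Support file for the crux item stmt-AtomisticToContinuum-6075 (`HalfSpaceUniqueContinuation`, line
`registered`, layered core, THICK-CLASS PEELING; infrastructure written by a stub-worker of lead c3).
For a horizontal direction `c ∈ V` (`dim V = 2`) the in-plane slice of the `c`-component of the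
kernel of a source at depth `t > 0` is `v ↦ ⟪c, v⟫ ((‖v‖² + t²)^{-4} − (‖v‖² + t²)^{-7})`
(`hbl_inner_kernel_coe_add_smul` with `⟪e, u⟫ = 0`). Its Fourier transform:
* **`hbl_fourier_horizontalSlice_zero`** — vanishes at `w = 0` (no net horizontal force of a layer);
* **`hbl_fourier_horizontalSlice`** — for `w ≠ 0`, `ρ = ‖w‖`, `c' = 2πρ`:
  `= −πi⟪c, w⟫ · ((π/6)(πρ)² t⁻² J₂(c',t) − (π/720)(πρ)⁵ t⁻⁵ J₅(c',t))`,
  `J_ν(c', t) = ∫ e^{νu − c' t cosh u} du` (gradient formula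
  `fourierIntegral_inner_mul_normSq_add_sq_rpow_neg` + `hbl_fourier_powerKernel_eq_besselJ`,
  `Γ(3) = 2`, `Γ(6) = 120`);
* **`hbl_hasSum_horizontalMode_eq_laplace'`** (+ registered `∀`-form
  `hbl_hasSum_horizontalMode_eq_laplace`) — summed over a family of layers with phases `θ q`,
  heights `y q`: `∑_q θ q 𝓕[slice_{X+y_q}](w) = −πi⟪c,w⟫ ((π/6)(πρ)² I₁ − (π/720)(πρ)⁵ I₂)`,
  `Iᵢ = ∫ e^{−l(X−t₀)} σ̃(l) d(besselLaplaceMeasure νᵢ pᵢ c' t₀)`, `(νᵢ, pᵢ) = (2,2), (5,5)`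
  (`hbl_hasSum_shell_eq_laplace_univ`).
All `[folklore]`; nothing here closes an item.
-/

noncomputable section

namespace Summit.AtomisticToContinuum.Crystallization.Theorems.HolmgrenBoyleLind

open scoped BigOperators Topology InnerProductSpace RealInnerProductSpace FourierTransform
open MeasureTheory Filter Set Literature.Analysis.SpecialFunctions Literature.Analysis.Fourier

section Horizontal

variable {V : Type*} [NormedAddCommGroup V] [InnerProductSpace ℝ V] [FiniteDimensional ℝ V]
  [MeasurableSpace V] [BorelSpace V]

/-- **The horizontal slice transform at frequency `0` vanishes** (`t > 0`):
`𝓕[⟪c,·⟫((‖·‖² + t²)^{-4} − (‖·‖² + t²)^{-7})](0) = 0`. [folklore] -/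
theorem hbl_fourier_horizontalSlice_zero (hV : Module.finrank ℝ V = 2) {t : ℝ} (ht : 0 < t)
    (c : V) :
    𝓕 (fun v : V => (((⟪c, v⟫) * ((‖v‖ ^ 2 + t ^ 2) ^ (-(4 : ℝ)) - (‖v‖ ^ 2 + t ^ 2) ^ (-(7 : ℝ))) :
      ℝ) : ℂ)) 0 = 0 := by
  -- `⟪c, v⟫ = ⟪c, v⟫ + t·0`: the slice formula of part 11 with vanishing vertical weight
  have hfun : (fun v : V => (((⟪c, v⟫) * ((‖v‖ ^ 2 + t ^ 2) ^ (-(4 : ℝ)) -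
      (‖v‖ ^ 2 + t ^ 2) ^ (-(7 : ℝ))) : ℝ) : ℂ)) = fun v : V => ((((⟪c, v⟫ + t * 0) *
        ((‖v‖ ^ 2 + t ^ 2) ^ (-(4 : ℝ)) - (‖v‖ ^ 2 + t ^ 2) ^ (-(7 : ℝ)))) : ℝ) : ℂ) := by
    funext v; rw [mul_zero, add_zero]
  rw [hfun, hbl_fourierIntegral_slice' hV c 0 ht.ne' (0 : V)]
  simp

/-- **The horizontal slice transform off the zero mode** (`dim V = 2`, `t > 0`, `w ≠ 0`), with
`ρ = ‖w‖`, `c' = 2πρ`: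
`𝓕[⟪c,·⟫((‖·‖² + t²)^{-4} − (‖·‖² + t²)^{-7})](w)
  = −πi⟪c, w⟫ ((π/6)(πρ)² t⁻² J₂(c',t) − (π/720)(πρ)⁵ t⁻⁵ J₅(c',t))`,
`J_ν(c', t) = ∫ e^{νu − c' t cosh u} du`. [folklore] -/
theorem hbl_fourier_horizontalSlice (hV : Module.finrank ℝ V = 2) {t : ℝ} (ht : 0 < t) (c : V)
    {w : V} (hw : w ≠ 0) :
    𝓕 (fun v : V => (((⟪c, v⟫) * ((‖v‖ ^ 2 + t ^ 2) ^ (-(4 : ℝ)) - (‖v‖ ^ 2 + t ^ 2) ^ (-(7 : ℝ))) :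
      ℝ) : ℂ)) w =
      -(Real.pi * Complex.I * (⟪c, w⟫ : ℝ)) *
        (((Real.pi / 6 * (Real.pi * ‖w‖) ^ 2) *
            ((t ^ (-(2 : ℝ)) : ℝ) * ∫ u : ℝ, Real.exp (2 * u - 2 * Real.pi * ‖w‖ * t * Real.cosh u)) -
          (Real.pi / 720 * (Real.pi * ‖w‖) ^ 5) *
            ((t ^ (-(5 : ℝ)) : ℝ) * ∫ u : ℝ, Real.exp (5 * u - 2 * Real.pi * ‖w‖ * t * Real.cosh u)) :
          ℝ) : ℂ) := by
  -- `⟪c, v⟫ = ⟪c, v⟫ + t·0`: the slice formula of part 11 with vanishing vertical weight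
  have hfun : (fun v : V => (((⟪c, v⟫) * ((‖v‖ ^ 2 + t ^ 2) ^ (-(4 : ℝ)) -
      (‖v‖ ^ 2 + t ^ 2) ^ (-(7 : ℝ))) : ℝ) : ℂ)) = fun v : V => ((((⟪c, v⟫ + t * 0) *
        ((‖v‖ ^ 2 + t ^ 2) ^ (-(4 : ℝ)) - (‖v‖ ^ 2 + t ^ 2) ^ (-(7 : ℝ)))) : ℝ) : ℂ) := by
    funext v; rw [mul_zero, add_zero]
  -- the two power kernels in cosh form, `s = 3, 6`
  have h3 := hbl_fourier_powerKernel_eq_besselJ hV (by norm_num : (1 : ℝ) < 3) ht hw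
  have h6 := hbl_fourier_powerKernel_eq_besselJ hV (by norm_num : (1 : ℝ) < 6) ht hw
  rw [show (3 : ℝ) - 1 = 2 by norm_num, hbl_Gamma_three] at h3
  rw [show (6 : ℝ) - 1 = 5 by norm_num, hbl_Gamma_six] at h6
  rw [hfun, hbl_fourierIntegral_slice' hV c 0 ht.ne' w, h3, h6]
  simp only [mul_zero, Complex.ofReal_zero, zero_mul, add_zero]
  congr 1
  rw [show (1 / 3 : ℂ) = ((1 / 3 : ℝ) : ℂ) by norm_num, show (1 / 6 : ℂ) = ((1 / 6 : ℝ) : ℂ) by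
    norm_num, ← Complex.ofReal_mul, ← Complex.ofReal_mul, ← Complex.ofReal_sub, Complex.ofReal_inj]
  simp only [Real.rpow_neg ht.le, Real.rpow_ofNat]
  field_simp
  ring

/-- **The horizontal mode of a family of source layers as a signed pair of Laplace transforms.**
Phases `θ q` (`‖θ q‖ ≤ 1`), heights `y q ≥ 0` with window count `N`, frequency `w ≠ 0`
(`c' = 2π‖w‖`), `X > t₀ > 0`:
`∑_q θ q 𝓕[slice_{X + y_q}](w) = −πi⟪c,w⟫ ((π/6)(π‖w‖)² I₁ − (π/720)(π‖w‖)⁵ I₂)` with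
`Iᵢ = ∫ e^{−l(X − t₀)} (∑_q θ q e^{−y_q max(l,c')}) d(besselLaplaceMeasure νᵢ pᵢ c' t₀)(l)`,
`(ν₁, p₁) = (2, 2)`, `(ν₂, p₂) = (5, 5)`. [folklore] -/
theorem hbl_hasSum_horizontalMode_eq_laplace' (hV : Module.finrank ℝ V = 2) {ι : Type*}
    [Countable ι] {θ : ι → ℂ} {y : ι → ℝ} {N : ℕ} (hθ : ∀ q, ‖θ q‖ ≤ 1) (hy : ∀ q, 0 ≤ y q)
    (hN : ∀ j : ℕ, {q : ι | (j : ℝ) ≤ y q ∧ y q ≤ j + 1}.encard ≤ N) (c : V) {w : V} (hw : w ≠ 0)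
    {t₀ X : ℝ} (ht₀ : 0 < t₀) (hX : t₀ < X) :
    HasSum (fun q => θ q *
        𝓕 (fun v : V => (((⟪c, v⟫) *
          ((‖v‖ ^ 2 + (X + y q) ^ 2) ^ (-(4 : ℝ)) - (‖v‖ ^ 2 + (X + y q) ^ 2) ^ (-(7 : ℝ))) : ℝ) : ℂ))
          w)
      (-(Real.pi * Complex.I * (⟪c, w⟫ : ℝ)) *
        ((((Real.pi / 6 * (Real.pi * ‖w‖) ^ 2 : ℝ)) : ℂ) *
            (∫ l, Complex.exp (-((l * (X - t₀) : ℝ) : ℂ)) *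
                (∑' q, θ q * Complex.exp (-((y q : ℂ) * ((max l (2 * Real.pi * ‖w‖) : ℝ) : ℂ))))
              ∂(besselLaplaceMeasure 2 2 (2 * Real.pi * ‖w‖) t₀)) -
          (((Real.pi / 720 * (Real.pi * ‖w‖) ^ 5 : ℝ)) : ℂ) *
            (∫ l, Complex.exp (-((l * (X - t₀) : ℝ) : ℂ)) *
                (∑' q, θ q * Complex.exp (-((y q : ℂ) * ((max l (2 * Real.pi * ‖w‖) : ℝ) : ℂ))))
              ∂(besselLaplaceMeasure 5 5 (2 * Real.pi * ‖w‖) t₀)))) := by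
  have hc : 0 < 2 * Real.pi * ‖w‖ := by have := norm_pos_iff.2 hw; positivity
  -- the two shells `(ν, p) = (2, 2)` and `(5, 5)` as Laplace transforms
  have L1 := hbl_hasSum_shell_eq_laplace_univ hθ hy hN 2 (p := 2) two_pos hc ht₀ hX
  have L2 := hbl_hasSum_shell_eq_laplace_univ hθ hy hN 5 (p := 5) (by norm_num) hc ht₀ hX
  refine (((L1.mul_left ((Real.pi / 6 * (Real.pi * ‖w‖) ^ 2 : ℝ) : ℂ)).sub
    (L2.mul_left ((Real.pi / 720 * (Real.pi * ‖w‖) ^ 5 : ℝ) : ℂ))).mul_left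
      (-(Real.pi * Complex.I * (⟪c, w⟫ : ℝ)))).congr_fun fun q => ?_
  have htq : 0 < X + y q := by linarith [hy q]
  rw [hbl_fourier_horizontalSlice hV htq c hw]
  push_cast
  ring

end Horizontal

open FourierTransform renaming fourier → Real.fourierIntegral in
/-- **The horizontal mode of a family of source layers as a signed pair of Laplace transforms**,
registered form (`V ι : Type`; `𝓕` spelled `Real.fourierIntegral` via the `open … renaming`
above so that the registered header elaborates verbatim). [folklore] -/
theorem hbl_hasSum_horizontalMode_eq_laplace : ∀ {V : Type} [NormedAddCommGroup V] [InnerProductSpace ℝ V] [FiniteDimensional ℝ V] [MeasurableSpace V] [BorelSpace V], Module.finrank ℝ V = 2 → ∀ {ι : Type} [Countable ι] {θ : ι → ℂ} {y : ι → ℝ} {N : ℕ}, (∀ q, ‖θ q‖ ≤ 1) → (∀ q, 0 ≤ y q) → (∀ j : ℕ, {q : ι | (j : ℝ) ≤ y q ∧ y q ≤ j + 1}.encard ≤ N) → ∀ (c : V) {w : V}, w ≠ 0 → ∀ {t₀ X : ℝ}, 0 < t₀ → t₀ < X → HasSum (fun q => θ q * Real.fourierIntegral (fun v : V => (((inner ℝ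 c v) * ((‖v‖ ^ 2 + (X + y q) ^ 2) ^ (-(4 : ℝ)) - (‖v‖ ^ 2 + (X + y q) ^ 2) ^ (-(7 : ℝ))) : ℝ) : ℂ)) w) (-(Real.pi * Complex.I * (inner ℝ c w : ℝ)) * ((((Real.pi / 6 * (Real.pi * ‖w‖) ^ 2 : ℝ)) : ℂ) * (∫ l, Complex.exp (-((l * (X - t₀) : ℝ) : ℂ)) * (∑' q, θ q * Complex.exp (-((y q : ℂ) * ((max l (2 * Real.pi * ‖w‖) : ℝ) : ℂ)))) ∂(Literature.Analysis.SpecialFunctions.besselLaplaceMeasure 2 2 (2 * Real.pi * ‖w‖) t₀)) - (((Real.pi / 720 * (Real.pi * ‖w‖) ^ 5 : ℝ)) : ℂ) * (∫ l, Complex.exp (-((l * (X - t₀) : ℝ) : ℂ)) * (∑' q, θ q * Complex.exp (-((y q : ℂ) * ((max l (2 * Real.pi * ‖w‖) : ℝ) : ℂ)))) ∂(Literature.Analysis.SpecialFunctions.besselLaplaceMeasure 5 5 (2 * Real.pi * ‖w‖) t₀)))) := by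
  intro V _ _ _ _ _ hV ι _ θ y N hθ hy hN c w hw t₀ X ht₀ hX
  exact hbl_hasSum_horizontalMode_eq_laplace' hV hθ hy hN c hw ht₀ hX

end Summit.AtomisticToContinuum.Crystallization.Theorems.HolmgrenBoyleLind

end
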